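import Summits.CriticalPhenomena.PercolationContinuityZ3.Theorems.SubcritExchangeUniformity.Negative.VerticalRusso
import Summits.CriticalPhenomena.PercolationContinuityZ3.Theorems.PercExchangeRateTransportSubcritExchangeUniformityStubSlopePositiveOnCurve

/-!
# `SubcritExchangeUniformity` (K⁻, crux stmt-CriticalPhenomena-16062), negative lane, line `onesided`:
# the boundary effect at `p = 0` bites `stub_upperSubcurveBound`, not `stub_lowerSubcurveBound`

Stub-level companions of THE GUARD (`CutoffGuard.delta_lt_pcurve`) for the picked line
`Cruxes/SubcritExchangeUniformity/Lines/onesided.lean` (cdisprove, cycle 1; theorem-only, nothing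
asserts a Theses decl or a stub positively).

* `delta_lt_pcurve_of_upperSubcurve` — if the cross-multiplied UPPER sub-curve inequality of stub 3,
  `∂_tΘ_n(p,t) ∂_pΘ_n(p_c t,t) ≤ ∂_tΘ_n(p_c t,t) ∂_pΘ_n(p,t) + η ∂_pΘ_n(p,t) ∂_pΘ_n(p_c t,t)`, holds at
  a level `t ∈ (0,1)` for all `n ≥ m` on the strip `[p_c(t) − δ, p_c(t)]`, then `δ < p_c(t)`: at
  `p = 0` the right-hand side vanishes (`∂_pΘ_n(0,t) = 0`, `Objects`) while the left-hand side is
  `∂_tΘ_n(0,t) ∂_pΘ_n(p_c t,t) > 0` (`VerticalRusso.deriv_t_pos` and the landed stub 4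
  `stub_slopePositiveOnCurve`, p168651). So a prover of stub 3 must take `δ(η) < inf_{[lo,hi]} p_c`,
  exactly as for K⁻.
* `upperSubcurveBound_false_without_cutoff` — stub 3 with the strip replaced by the closed segment
  `0 ≤ p ≤ p_c(t)` (`∃ δ` dropped; the registered `let`-preamble verbatim) is FALSE.
* `lowerSubcurve_ineq_of_nonpos` — by contrast the LOWER sub-curve inequality of stub 2 (the
  load-bearing half) HOLDS at every `p ≤ 0` for trivial reasons (its left-hand side vanishes and its
  right-hand side is `∂_tΘ_n(p,t) ∂_pΘ_n(p_c t,t) ≥ 0`): the boundary effect gives no information on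
  stub 2.
-/

noncomputable section

namespace Summit.CriticalPhenomena.PercolationContinuityZ3.Theorems.SubcritExchangeUniformity.Negative

open MeasureTheory Filter Topology
open Literature.Probability.Percolation Literature.Probability.LatticeModels
open Summit.CriticalPhenomena.PercolationContinuityZ3.Theorems.SubcritExchangeUniformity
  (stub_slopePositiveOnCurve)

/-- `0 < ∂_pΘ_n(p_c(t),t)` for `n ≥ 1`, `t ∈ (0,1)` — the landed stub 4 of the line, read over the
named objects (sub-arc `[t/2,(t+1)/2]`). [folklore] -/
theorem deriv_p_pos_on_curve {n : ℕ} (hn : 1 ≤ n) {t : ℝ} (ht : t ∈ Set.Ioo (0 : ℝ) 1) :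
    0 < deriv (fun q => ThetaBox n q t) (pcurve t) :=
  stub_slopePositiveOnCurve (t / 2) ((t + 1) / 2) (by linarith [ht.1]) (by linarith [ht.2])
    (by linarith [ht.2]) n hn t ⟨by linarith [ht.1], by linarith [ht.2]⟩

/-- **Guard for stub 3 (`UpperSubcurveBound`).** If its cross-multiplied inequality holds at a level
`t ∈ (0,1)` for all `n ≥ m` on the strip `[p_c(t) − δ, p_c(t)]`, then `δ < p_c(t)`. [folklore] -/
theorem delta_lt_pcurve_of_upperSubcurve {η δ : ℝ} {m : ℕ} {t : ℝ} (ht : t ∈ Set.Ioo (0 : ℝ) 1)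
    (h : ∀ n ≥ m, ∀ p : ℝ, pcurve t - δ ≤ p → p ≤ pcurve t →
      deriv (fun s => ThetaBox n p s) t * deriv (fun q => ThetaBox n q t) (pcurve t) ≤
        deriv (fun s => ThetaBox n (pcurve t) s) t * deriv (fun q => ThetaBox n q t) p +
          η * deriv (fun q => ThetaBox n q t) p * deriv (fun q => ThetaBox n q t) (pcurve t)) :
    δ < pcurve t := by
  by_contra hδ
  rw [not_lt] at hδ
  have key := h (max m 1) (le_max_left _ _) 0 (by linarith) (pcurve_nonneg t)
  rw [deriv_p_eq_zero_of_nonpos (max m 1) t le_rfl] at key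
  simp only [mul_zero, zero_mul, add_zero] at key
  have hτ := deriv_t_pos (max m 1) (le_max_right _ _) zero_lt_one ht (p := 0)
  have hD := deriv_p_pos_on_curve (le_max_right m 1) ht
  exact absurd key (not_le.2 (mul_pos hτ hD))

/-- **Stub 3 WITHOUT the `δ(η)`-cutoff is false.** The registered `stub_upperSubcurveBound` of line
`onesided` with the strip `p_c(t) − δ ≤ p ≤ p_c(t)` replaced by the closed segment `0 ≤ p ≤ p_c(t)`
(`∃ δ > 0` dropped; `let`-preamble verbatim): witness `[1/4,1/2]`, `η = 1`, `t = 1/4`, `p = 0`.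
[folklore] -/
theorem upperSubcurveBound_false_without_cutoff :
    ¬ (let μ := labelMeasure (Site 3)
       let vert : Sym2 (Site 3) → Prop := fun e => ∃ x : Site 3, e = s(x, x + Pi.single (2 : Fin 3) 1)
       let cfg : ℝ → ℝ → (Sym2 (Site 3) → ℝ) → Set (Sym2 (Site 3)) := fun p t U =>
         {e | e ∈ (zdGraph 3).edgeSet ∧ ((vert e ∧ U e ≤ t) ∨ (¬ vert e ∧ U e ≤ p))}
       let Θ : ℕ → ℝ → ℝ → ℝ := fun n p t => μ.real {U | cfg p t U ∈ siteToBoundary 3 n}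
       let θ : ℝ → ℝ → ℝ := fun p t => μ.real {U | cfg p t U ∈ percolatesAt (0 : Site 3)}
       let pc : ℝ → ℝ := fun t => sInf ({p : ℝ | 0 ≤ p ∧ p ≤ 1 ∧ 0 < θ p t} ∪ {1})
       ∀ lo hi : ℝ, 0 < lo → lo < hi → hi < 1 →
         ∀ η > (0 : ℝ), ∃ m : ℕ, ∀ n ≥ m, ∀ t ∈ Set.Icc lo hi, ∀ p : ℝ, 0 ≤ p → p ≤ pc t →
           deriv (fun s => Θ n p s) t * deriv (fun q => Θ n q t) (pc t) ≤
             deriv (fun s => Θ n (pc t) s) t * deriv (fun q => Θ n q t) p +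
               η * deriv (fun q => Θ n q t) p * deriv (fun q => Θ n q t) (pc t)) := by
  intro h
  obtain ⟨m, hm⟩ := h (1 / 4) (1 / 2) (by norm_num) (by norm_num) (by norm_num) 1 one_pos
  have ht : (1 / 4 : ℝ) ∈ Set.Ioo (0 : ℝ) 1 := ⟨by norm_num, by norm_num⟩
  have hmem : (1 / 4 : ℝ) ∈ Set.Icc (1 / 4 : ℝ) (1 / 2) := ⟨le_rfl, by norm_num⟩
  exact lt_irrefl _ (delta_lt_pcurve_of_upperSubcurve (η := 1) (δ := pcurve (1 / 4)) (m := m) ht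
    fun n hn p hp1 hp2 => hm n hn (1 / 4) hmem p (by linarith) hp2)

/-- **The boundary effect does not touch stub 2 (`LowerSubcurveBound`).** Its cross-multiplied
inequality holds at every `p ≤ 0` (any real `η`): the left-hand side vanishes with `∂_pΘ_n(p,t) = 0`
and the right-hand side is a product of two positive derivatives. [folklore] -/
theorem lowerSubcurve_ineq_of_nonpos {n : ℕ} (hn : 1 ≤ n) {t : ℝ} (ht : t ∈ Set.Ioo (0 : ℝ) 1)
    {p : ℝ} (hp : p ≤ 0) (η : ℝ) :
    deriv (fun s => ThetaBox n (pcurve t) s) t * deriv (fun q => ThetaBox n q t) p -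
        η * deriv (fun q => ThetaBox n q t) p * deriv (fun q => ThetaBox n q t) (pcurve t) ≤
      deriv (fun s => ThetaBox n p s) t * deriv (fun q => ThetaBox n q t) (pcurve t) := by
  rw [deriv_p_eq_zero_of_nonpos n t hp]
  simp only [mul_zero, zero_mul, sub_zero]
  exact (mul_pos (deriv_t_pos n hn (hp.trans_lt zero_lt_one) ht) (deriv_p_pos_on_curve hn ht)).le

end Summit.CriticalPhenomena.PercolationContinuityZ3.Theorems.SubcritExchangeUniformity.Negative

end
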